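import Summits.NavierStokesRegularity.FunctionalMining.TopEigTransportSelection
import Literature.Analysis.FluidPDE.TorusClassicalNSTimeDerivLinearised
import HarnessLib

/-!
# FunctionalMining — the transport drops out of the Danskin rate of `Φ_q` (LEMMA ADV, rate form)

Search for candidate a priori estimates; no regularity claim. Cell `pub-nsfunc`, prove seat
(gen 24), on top of `TopEigTransport` / `TopEigTransportSelection` (LEMMA ADV in selection form:
the one-sided channels `W μ(S; ∂ₖS)` of the weight `W = q λ₁^{q−1}` are two-sided a.e., every top
vector sees them, and `∫ Σₖ wₖ · W μ(S; ∂ₖS) = 0`). Notation: `v, w` smooth on `T^d`, `div v = div w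
= 0`, `q ≥ 1`, `S = strainFlat v`, `μ = dirTopEig`, `T(x) = Σₖ wₖ(x) ∂ₖS(x)` the transport tensor.

The Danskin functional `M ↦ μ(A; M)` is convex and NOT additive; nevertheless the transport is
additive inside it almost everywhere, because at a two-sided point the quadratic form of `T(x)` is
CONSTANT on the top eigen-set of `S(x)`:

* `TopEig.dirTopEig_add_of_quad_eq` / `…_sub_…` — if `eᵀTe = τ` for every unit top vector `e` of
  `A`, then `μ(A; X ± T) = μ(A; X) ± τ` for every `X`;
* `TopEig.topEigWeight_dirTopEig_sub_sum_smul_eq` — at a point two-sided in every channel,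
  `W μ(A; X − Σₖ cₖNₖ) = W μ(A; X) − Σₖ cₖ · W μ(A; Nₖ)` for EVERY `X` (also with `+`);
* `TopEig.ae_topEigWeight_dirTopEig_sub_transport` — on the torus this holds for a.e. `x`,
  simultaneously for all directions `X`;
* **`TopEig.integral_topEigWeight_dirTopEig_sub_transport`** — for every CONTINUOUS direction field
  `X`: `∫ q λ₁^{q−1} μ(S; X − Σₖ wₖ ∂ₖS) dx = ∫ q λ₁^{q−1} μ(S; X) dx` (and with `+`): the transport
  drops out of every Danskin rate, exactly;
* **`TopEig.hasDerivWithinAt_topEigMoment_navierStokes_transportFree`** — along a classical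
  solution of `∂ₜu + (u·∇)u = νΔu − ∇p + f`, `div u = 0` on `T^d × [a, b]` and `t ∈ [a, b)`,
  `s ↦ Φ_q(u(s))` has the RIGHT derivative `∫ q λ₁^{q−1} μ(S; νΔS − Π(p) + S(f) − N(u)) dx` at `t`:
  the tree's `hasDerivWithinAt_topEigMoment_navierStokes` (`TopEigProductionRate`) WITHOUT the
  transport term `−Σₖ uₖ ∂ₖS` inside `μ`; `…_Icc` the initial-time form within `[a, b]`.

Refutation bookkeeping for CANDIDATE a priori inequalities (the exact one-sided production rate of
the `λ₁` rows `ES.lam1.q`, now transport-free); nothing here is about Navier–Stokes regularity.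
[ours; Danskin folklore, QN4-NOTE LEMMA ADV of the no-go seat]
-/

noncomputable section

open MeasureTheory Set Filter Topology

namespace Summit.NavierStokesRegularity.FunctionalMining

open Literature.Analysis.FunctionSpaces Literature.Analysis.FluidPDE

namespace TopEig

open StrainL4 StrainTensor

variable {d : Type*} [Fintype d] [DecidableEq d] [Nonempty d]

/-! ## 1. A direction whose form is constant on the top eigen-set is additive inside `μ` -/

/-- If `eᵀTe = τ` for every unit top vector `e` of `A`, then `μ(A; X + T) = μ(A; X) + τ` for every
`X`. [ours] -/
theorem dirTopEig_add_of_quad_eq {A X T : EuclideanSpace ℝ (d × d)} {τ : ℝ}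
    (hT : ∀ e ∈ topEigSet A, quad T e = τ) : dirTopEig A (X + T) = dirTopEig A X + τ := by
  refine le_antisymm (dirTopEig_le fun e he => ?_) ?_
  · rw [quad_add, hT e he]
    linarith [quad_le_dirTopEig X he]
  · obtain ⟨e, he, hq⟩ := exists_quad_eq_dirTopEig A X
    have h := quad_le_dirTopEig (X + T) he
    rwa [quad_add, hq, hT e he] at h

/-- If `eᵀTe = τ` for every unit top vector `e` of `A`, then `μ(A; X − T) = μ(A; X) − τ` for every
`X`. [ours] -/
theorem dirTopEig_sub_of_quad_eq {A X T : EuclideanSpace ℝ (d × d)} {τ : ℝ}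
    (hT : ∀ e ∈ topEigSet A, quad T e = τ) : dirTopEig A (X - T) = dirTopEig A X - τ := by
  have h := dirTopEig_add_of_quad_eq (X := X) (T := -T) (τ := -τ) fun e he => by
    rw [← neg_one_smul ℝ T, quad_smul, hT e he, neg_one_mul]
  rwa [← sub_eq_add_neg, ← sub_eq_add_neg] at h

/-- **At a point two-sided in every channel the transport is additive inside the weighted `μ`**:
`W μ(A; X − Σₖ cₖNₖ) = W μ(A; X) − Σₖ cₖ · W μ(A; Nₖ)` for every direction `X` (if `W = 0` both
sides vanish; if `W > 0` the form of `Σₖ cₖNₖ` is constant on the top eigen-set,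
`topEigWeight_quad_sum_smul_eq`). [ours] -/
theorem topEigWeight_dirTopEig_sub_sum_smul_eq {ι : Type*} [Fintype ι] {A : EuclideanSpace ℝ (d × d)}
    {N : ι → EuclideanSpace ℝ (d × d)} {W : ℝ} (hW : 0 ≤ W)
    (h : ∀ k, W * dirTopEig A (-N k) = -(W * dirTopEig A (N k))) (c : ι → ℝ)
    (X : EuclideanSpace ℝ (d × d)) :
    W * dirTopEig A (X - ∑ k, c k • N k) = W * dirTopEig A X - ∑ k, c k * (W * dirTopEig A (N k)) := by
  rcases hW.eq_or_lt with hW0 | hWpos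
  · simp [← hW0]
  · have hT : ∀ e ∈ topEigSet A, quad (∑ k, c k • N k) e =
        (∑ k, c k * (W * dirTopEig A (N k))) / W := fun e he => by
      rw [eq_div_iff hWpos.ne', mul_comm]
      exact topEigWeight_quad_sum_smul_eq hW h c he
    rw [dirTopEig_sub_of_quad_eq hT, mul_sub, mul_div_assoc', mul_div_cancel_left₀ _ hWpos.ne']

/-- The same with `+`: `W μ(A; X + Σₖ cₖNₖ) = W μ(A; X) + Σₖ cₖ · W μ(A; Nₖ)`. [ours] -/
theorem topEigWeight_dirTopEig_add_sum_smul_eq {ι : Type*} [Fintype ι] {A : EuclideanSpace ℝ (d × d)}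
    {N : ι → EuclideanSpace ℝ (d × d)} {W : ℝ} (hW : 0 ≤ W)
    (h : ∀ k, W * dirTopEig A (-N k) = -(W * dirTopEig A (N k))) (c : ι → ℝ)
    (X : EuclideanSpace ℝ (d × d)) :
    W * dirTopEig A (X + ∑ k, c k • N k) = W * dirTopEig A X + ∑ k, c k * (W * dirTopEig A (N k)) := by
  rcases hW.eq_or_lt with hW0 | hWpos
  · simp [← hW0]
  · have hT : ∀ e ∈ topEigSet A, quad (∑ k, c k • N k) e =
        (∑ k, c k * (W * dirTopEig A (N k))) / W := fun e he => by
      rw [eq_div_iff hWpos.ne', mul_comm]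
      exact topEigWeight_quad_sum_smul_eq hW h c he
    rw [dirTopEig_add_of_quad_eq hT, mul_add, mul_div_assoc', mul_div_cancel_left₀ _ hWpos.ne']

/-! ## 2. On the torus: the transport is additive inside the weighted `μ`, almost everywhere -/

variable {v : UnitAddTorus d → EuclideanSpace ℝ d} {q : ℝ}

/-- **For a.e. `x` and EVERY direction `X`**:
`q λ₁^{q−1} μ(S; X − Σₖ cₖ(x) ∂ₖS(x)) = q λ₁^{q−1} μ(S; X) − Σₖ cₖ(x) · q λ₁^{q−1} μ(S; ∂ₖS(x))`
(smooth divergence-free `v`, `q ≥ 1`, any coefficient field `c`). [ours] -/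
theorem ae_topEigWeight_dirTopEig_sub_transport (hq : 1 ≤ q) (hv : Torus.IsSmooth v)
    (hdv : Torus.IsDivFree v) (c : UnitAddTorus d → d → ℝ) :
    ∀ᵐ x : UnitAddTorus d, ∀ X : EuclideanSpace ℝ (d × d),
      q * torusStrainTopEig v x ^ (q - 1) *
          dirTopEig (strainFlat v x) (X - ∑ k, c x k • Torus.partialDeriv k (strainFlat v) x) =
        q * torusStrainTopEig v x ^ (q - 1) * dirTopEig (strainFlat v x) X -
          ∑ k, c x k * (q * torusStrainTopEig v x ^ (q - 1) *
            dirTopEig (strainFlat v x) (Torus.partialDeriv k (strainFlat v) x)) := by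
  have h := ae_all_iff.2 fun k : d =>
    ae_topEigWeight_dirTopEig_neg_lineDeriv hq hv hdv (EuclideanSpace.single k (1 : ℝ))
  filter_upwards [h] with x hx X
  have hl : 0 ≤ torusStrainTopEig v x := by
    rw [← lam_strainFlat]; exact lam_strainFlat_nonneg hv hdv x
  have hW : 0 ≤ q * torusStrainTopEig v x ^ (q - 1) := mul_nonneg (by linarith) (Real.rpow_nonneg hl _)
  exact topEigWeight_dirTopEig_sub_sum_smul_eq (N := fun k => Torus.partialDeriv k (strainFlat v) x) hW
    (fun k => hx k) (c x) X

/-- The same with `+`: for a.e. `x` and every `X`,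
`q λ₁^{q−1} μ(S; X + Σₖ cₖ ∂ₖS) = q λ₁^{q−1} μ(S; X) + Σₖ cₖ · q λ₁^{q−1} μ(S; ∂ₖS)`. [ours] -/
theorem ae_topEigWeight_dirTopEig_add_transport (hq : 1 ≤ q) (hv : Torus.IsSmooth v)
    (hdv : Torus.IsDivFree v) (c : UnitAddTorus d → d → ℝ) :
    ∀ᵐ x : UnitAddTorus d, ∀ X : EuclideanSpace ℝ (d × d),
      q * torusStrainTopEig v x ^ (q - 1) *
          dirTopEig (strainFlat v x) (X + ∑ k, c x k • Torus.partialDeriv k (strainFlat v) x) =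
        q * torusStrainTopEig v x ^ (q - 1) * dirTopEig (strainFlat v x) X +
          ∑ k, c x k * (q * torusStrainTopEig v x ^ (q - 1) *
            dirTopEig (strainFlat v x) (Torus.partialDeriv k (strainFlat v) x)) := by
  have h := ae_all_iff.2 fun k : d =>
    ae_topEigWeight_dirTopEig_neg_lineDeriv hq hv hdv (EuclideanSpace.single k (1 : ℝ))
  filter_upwards [h] with x hx X
  have hl : 0 ≤ torusStrainTopEig v x := by
    rw [← lam_strainFlat]; exact lam_strainFlat_nonneg hv hdv x
  have hW : 0 ≤ q * torusStrainTopEig v x ^ (q - 1) := mul_nonneg (by linarith) (Real.rpow_nonneg hl _)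
  exact topEigWeight_dirTopEig_add_sum_smul_eq (N := fun k => Torus.partialDeriv k (strainFlat v) x) hW
    (fun k => hx k) (c x) X

/-! ## 3. The transport drops out of every Danskin rate -/

/-- **`∫ q λ₁^{q−1} μ(S; X − Σₖ wₖ ∂ₖS) dx = ∫ q λ₁^{q−1} μ(S; X) dx`** for smooth divergence-free
`v, w`, `q ≥ 1` and every CONTINUOUS direction field `X` (a.e. additivity, and the transport channels
integrate to zero, `integral_transport_topEigWeight_eq_zero`). [ours; LEMMA ADV, rate form] -/
theorem integral_topEigWeight_dirTopEig_sub_transport (hq : 1 ≤ q) (hv : Torus.IsSmooth v)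
    (hdv : Torus.IsDivFree v) {w : UnitAddTorus d → EuclideanSpace ℝ d} (hw : Torus.IsSmooth w)
    (hdw : Torus.IsDivFree w) {X : UnitAddTorus d → EuclideanSpace ℝ (d × d)} (hX : Continuous X) :
    ∫ x, q * torusStrainTopEig v x ^ (q - 1) *
        dirTopEig (strainFlat v x) (X x - ∑ k, w x k • Torus.partialDeriv k (strainFlat v) x) =
      ∫ x, q * torusStrainTopEig v x ^ (q - 1) * dirTopEig (strainFlat v x) (X x) := by
  have hS := isSmooth_strainFlat hv
  have hint1 : Integrable (fun x => q * torusStrainTopEig v x ^ (q - 1) *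
      dirTopEig (strainFlat v x) (X x)) volume := integrable_topEigDensity hq hv hdv hX
  have hint2 : Integrable (fun x => ∑ k, w x k * (q * torusStrainTopEig v x ^ (q - 1) *
      dirTopEig (strainFlat v x) (Torus.partialDeriv k (strainFlat v) x))) volume :=
    integrable_finsetSum _ fun k _ => integrable_continuous_mul (hw.apply k).continuous
      (integrable_topEigDensity hq hv hdv (hS.partialDeriv k).continuous)
  have hae := ae_topEigWeight_dirTopEig_sub_transport hq hv hdv (fun x k => w x k)
  calc ∫ x, q * torusStrainTopEig v x ^ (q - 1) *
        dirTopEig (strainFlat v x) (X x - ∑ k, w x k • Torus.partialDeriv k (strainFlat v) x)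
      = ∫ x, (q * torusStrainTopEig v x ^ (q - 1) * dirTopEig (strainFlat v x) (X x) -
          ∑ k, w x k * (q * torusStrainTopEig v x ^ (q - 1) *
            dirTopEig (strainFlat v x) (Torus.partialDeriv k (strainFlat v) x))) := by
        refine integral_congr_ae ?_
        filter_upwards [hae] with x hx
        exact hx (X x)
    _ = ∫ x, q * torusStrainTopEig v x ^ (q - 1) * dirTopEig (strainFlat v x) (X x) := by
        rw [integral_sub hint1 hint2, integral_transport_topEigWeight_eq_zero hq hv hdv hw hdw, sub_zero]

/-- The same with `+`: `∫ q λ₁^{q−1} μ(S; X + Σₖ wₖ ∂ₖS) dx = ∫ q λ₁^{q−1} μ(S; X) dx`. [ours] -/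
theorem integral_topEigWeight_dirTopEig_add_transport (hq : 1 ≤ q) (hv : Torus.IsSmooth v)
    (hdv : Torus.IsDivFree v) {w : UnitAddTorus d → EuclideanSpace ℝ d} (hw : Torus.IsSmooth w)
    (hdw : Torus.IsDivFree w) {X : UnitAddTorus d → EuclideanSpace ℝ (d × d)} (hX : Continuous X) :
    ∫ x, q * torusStrainTopEig v x ^ (q - 1) *
        dirTopEig (strainFlat v x) (X x + ∑ k, w x k • Torus.partialDeriv k (strainFlat v) x) =
      ∫ x, q * torusStrainTopEig v x ^ (q - 1) * dirTopEig (strainFlat v x) (X x) := by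
  have hS := isSmooth_strainFlat hv
  have hint1 : Integrable (fun x => q * torusStrainTopEig v x ^ (q - 1) *
      dirTopEig (strainFlat v x) (X x)) volume := integrable_topEigDensity hq hv hdv hX
  have hint2 : Integrable (fun x => ∑ k, w x k * (q * torusStrainTopEig v x ^ (q - 1) *
      dirTopEig (strainFlat v x) (Torus.partialDeriv k (strainFlat v) x))) volume :=
    integrable_finsetSum _ fun k _ => integrable_continuous_mul (hw.apply k).continuous
      (integrable_topEigDensity hq hv hdv (hS.partialDeriv k).continuous)
  have hae := ae_topEigWeight_dirTopEig_add_transport hq hv hdv (fun x k => w x k)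
  calc ∫ x, q * torusStrainTopEig v x ^ (q - 1) *
        dirTopEig (strainFlat v x) (X x + ∑ k, w x k • Torus.partialDeriv k (strainFlat v) x)
      = ∫ x, (q * torusStrainTopEig v x ^ (q - 1) * dirTopEig (strainFlat v x) (X x) +
          ∑ k, w x k * (q * torusStrainTopEig v x ^ (q - 1) *
            dirTopEig (strainFlat v x) (Torus.partialDeriv k (strainFlat v) x))) := by
        refine integral_congr_ae ?_
        filter_upwards [hae] with x hx
        exact hx (X x)
    _ = ∫ x, q * torusStrainTopEig v x ^ (q - 1) * dirTopEig (strainFlat v x) (X x) := by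
        rw [integral_add hint1 hint2, integral_transport_topEigWeight_eq_zero hq hv hdv hw hdw, add_zero]

/-! ## 4. Along Navier–Stokes: the exact one-sided production of `Φ_q`, transport-free -/

/-- **Exact one-sided production of `∫(λ₁⁺)^q` along Navier–Stokes, transport-free.** For a
classical solution of `∂ₜu + (u·∇)u = νΔu − ∇p + f`, `div u = 0` on `T^d × [a, b]` (`a < b`), real
`q ≥ 1` and `t ∈ [a, b)`: `s ↦ Φ_q(u(s))` has RIGHT derivative
`∫ q λ₁^{q−1} μ(S; νΔS − Π(p) + S(f) − N(u)) dx` at `t` — the tree's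
`hasDerivWithinAt_topEigMoment_navierStokes` with the transport `−Σₖ uₖ ∂ₖS` removed from inside `μ`
(LEMMA ADV, rate form). Search for candidate a priori estimates; no regularity claim. [ours] -/
theorem hasDerivWithinAt_topEigMoment_navierStokes_transportFree {a b ν : ℝ} (hab : a < b)
    {f u : ℝ → UnitAddTorus d → EuclideanSpace ℝ d} {p : ℝ → UnitAddTorus d → ℝ}
    (h : Torus.IsClassicalNSSolutionOn (Icc a b) ν f u p) (hq : 1 ≤ q) {t : ℝ} (ht : t ∈ Ico a b) :
    HasDerivWithinAt (fun s => torusTopEigMoment q (u s))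
      (∫ x, q * torusStrainTopEig (u t) x ^ (q - 1) *
        dirTopEig (strainFlat (u t) x)
          (ν • Torus.laplacian (strainFlat (u t)) x - pressVec (p t) x +
            strainFlat (f t) x - nonlinVec (u t) x))
      (Set.Ioi t) t := by
  have ht' : t ∈ Icc a b := ⟨ht.1, ht.2.le⟩
  have hu : Torus.IsSmooth (u t) := h.smooth_velocity.isSmooth_slice ht'
  have hdu : Torus.IsDivFree (u t) := h.divFree t ht'
  have hp : Torus.IsSmooth (p t) := h.smooth_pressure.isSmooth_slice ht'
  have hf : Torus.IsSmooth (f t) := (h.smooth_force (uniqueDiffOn_Icc hab)).isSmooth_slice ht'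
  have hX : Continuous fun x => ν • Torus.laplacian (strainFlat (u t)) x - pressVec (p t) x +
      strainFlat (f t) x - nonlinVec (u t) x :=
    ((((isSmooth_strainFlat hu).laplacian.continuous.const_smul ν).sub
      (isSmooth_pressVec hp).continuous).add (continuous_strainFlat hf)).sub
      (isSmooth_nonlinVec hu).continuous
  exact (hasDerivWithinAt_topEigMoment_navierStokes hab h hq ht).congr_deriv
    (integral_topEigWeight_dirTopEig_sub_transport hq hu hdu hu hdu hX)

/-- The same at the initial time `a`, within `[a, b]` (the shape of the `HasInitialRate` /
`SaturatingLawSup` clauses): RIGHT derivative `∫ q λ₁^{q−1} μ(S; νΔS − Π(p) + S(f) − N(u)) dx` at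
`s = a`, transport-free. [ours] -/
theorem hasDerivWithinAt_topEigMoment_navierStokes_transportFree_Icc {a b ν : ℝ} (hab : a < b)
    {f u : ℝ → UnitAddTorus d → EuclideanSpace ℝ d} {p : ℝ → UnitAddTorus d → ℝ}
    (h : Torus.IsClassicalNSSolutionOn (Icc a b) ν f u p) (hq : 1 ≤ q) :
    HasDerivWithinAt (fun s => torusTopEigMoment q (u s))
      (∫ x, q * torusStrainTopEig (u a) x ^ (q - 1) *
        dirTopEig (strainFlat (u a) x)
          (ν • Torus.laplacian (strainFlat (u a)) x - pressVec (p a) x +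
            strainFlat (f a) x - nonlinVec (u a) x))
      (Set.Icc a b) a :=
  ((hasDerivWithinAt_Ioi_iff_Ici.1
    (hasDerivWithinAt_topEigMoment_navierStokes_transportFree hab h hq ⟨le_rfl, hab⟩))).mono
    Icc_subset_Ici_self

end TopEig

end Summit.NavierStokesRegularity.FunctionalMining

end
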